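import Summits.MatrixMultiplication.MatrixMultiplication.Theorems.SaturationLadderLevelOneEntropy

/-!
# The level-1 rectangular `CW_q` bound with all six patterns — III: the theorem, `α ≥ 77/267`, curve points (route `SaturationLadder`, lens 1, gen 20)

Part III of three (cell `decomp-mm`, lens 1 (grading / quantitative ladder), gen 20; parts I–II:
`SaturationLadderLevelOneLaw.lean`, `SaturationLadderLevelOneEntropy.lean`).

**Level-1 theorem** (`omegaRect_cwSix_le`). For `q ≥ 2`, counts `n₁,…,n₆` of the patterns
`(1,1,0), (0,1,1), (1,0,1), (2,0,0), (0,2,0), (0,0,2)` with `N₀ = ∑ nᵢ ≥ 1` and `x : ℕ`, if each of the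
three marginals `u = (u₀,u₁,u₂)` of the type, `X = (n₂+n₅+n₆, n₁+n₃, n₄)`, `Y = (n₃+n₄+n₆, n₁+n₂, n₅)`,
`Z = (n₁+n₄+n₅, n₂+n₃, n₆)`, satisfies the INTEGER certificate
`(q+2)^{N₀} · u₀^{u₀} u₁^{u₁} u₂^{u₂} ≤ N₀^{N₀} · q^x` (i.e. `N₀ (log(q+2) − H_nats(u/N₀)) ≤ x log q`),
then **`ω(n₁, n₂, n₃) ≤ x`**.  Pipeline = the lineage's (free diagonal → restriction
`stub_cwRectRestriction` → `R̃(⊕^V ⟨q^{Mn₁},q^{Mn₂},q^{Mn₃}⟩) = V q^{M ω(n₁,n₂,n₃)}` (ADVXXZ 2025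
Thm 3.2) → `R̃(CW_q^{⊗N}) ≤ (q+2)^N` → threshold), with a general, possibly slack, rate.

**Corollaries (new unconditional tree theorems; the certificates are decided by `decide`).**
* `omegaRect_267_77_267 : ω(267, 77, 267) = 534`, hence `ω(1, 77/267, 1) = 2` and
  **`α ≥ 77/267 = 0.28839…`** (`alpha_ge_77_267`).  The tree's proved `α` was `2/7 = 0.2857…`
  (`SaturationLadderAlphaTwoSevenths.lean`, the most the four-pattern family gives: fold price `2/q`,
  `q ≥ 7`); the level-1 `α`-content of `CW_q` is `0.2883936…` (`q = 6`), so level 1 is now essentially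
  exhausted in this currency: design `q = 6`, `X`-marginal natural `(1,6,1)/8`, `Y = Z = (362, 344, 6)/712`
  — the two corner patterns `(0,2,0), (0,0,2)` buy the `Y/Z`-entropy that the four-pattern family lacks
  at `q = 6` (`SaturationLadderAlphaTwoSevenths.entropyCondition_fails_six`).  Lighter member:
  `ω(87, 25, 87) = 174`, `α ≥ 25/87`.
* two points of the level-1 rectangular CURVE (not tight): `ω(1, 1/2, 1) ≤ 189/92 = 2.0543…`
  (`omegaRect_one_half_one_le`; level-1 optimum `2.05409`, print `2.04630` [LeGall2012]) and
  `ω(1, 2, 1) ≤ 278/85 = 3.2705…` (`omegaRect_one_two_one_le`; level-1 optimum `3.26979`;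
  `ω(1,2,1) = 3` is the conclusion of the route's crux `TailDescentTwo`).  At `t = 1` the same program
  returns `2.3871900` = Coppersmith–Winograd's level-1 bound (the tree's `cw_levelOne_numerics`,
  `CoppersmithWinograd1990_sec7_omega_lt`), which validates it; print currency for these points is the
  level-2/level-4 analyses (`CoppersmithWinograd1990_sec8`, `LeGall2014_cw4` are typed for SQUARE `ω`
  only — the rectangular level 2 is the lineage's open "layer T").

No new definitions, no named facts, no sorry.  References: Coppersmith–Winograd 1990 §6
[CoppersmithWinograd1990]; Bürgisser–Clausen–Shokrollahi 1997 §15.8 [BurgisserClausenShokrollahi1997];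
Le Gall 2014 App. A [LeGall2014]; Alman–Duan–Vassilevska Williams–Xu–Xu–Zhou 2025 Thm 3.2
[AlmanDuanVassilevskaWilliamsXuXuZhou2025]; Huang–Pan 1998 (2.8) [HuangPan1998]; Lotti–Romani 1983
[LottiRomani1983]; Le Gall 2012 Table 1 [LeGall2012].
-/

set_option linter.dupNamespace false
-- (single-conjunct summit: the namespace repeats `MatrixMultiplication`)

noncomputable section

open Finset
open scoped BigOperators

namespace Summit.MatrixMultiplication.MatrixMultiplication.Theorems.SaturationLadderLevelOne

open Literature.Computability.AlgebraicComplexity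
open Literature.Barriers.MatrixMultiplication
open Summit.MatrixMultiplication.MatrixMultiplication.Theorems.PerfectAmortisation
open Summit.MatrixMultiplication.MatrixMultiplication.Theorems.SaturationLadderExpSaturation

/-! ## §5 The level-1 theorem -/

/-- **The level-1 rectangular `CW_q` bound, all six patterns.**  For `q ≥ 2`, counts `n₁,…,n₆` of the
patterns `(1,1,0), (0,1,1), (1,0,1), (2,0,0), (0,2,0), (0,0,2)` (`N₀ = ∑ nᵢ ≥ 1`) and `x : ℕ` such that
the three marginals `X = (n₂+n₅+n₆, n₁+n₃, n₄)`, `Y = (n₃+n₄+n₆, n₁+n₂, n₅)`, `Z = (n₁+n₄+n₅, n₂+n₃, n₆)`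
each satisfy `(q+2)^{N₀} u₀^{u₀} u₁^{u₁} u₂^{u₂} ≤ N₀^{N₀} q^x`: **`ω(n₁, n₂, n₃) ≤ x`**
(format `⟨q^{Mn₁}, q^{Mn₂}, q^{Mn₃}⟩` = the matrix patterns' counts; first-power laser method on
`CW_q^{⊗N}`, `N = M N₀`, with Schönhage's theorem in the form ADVXXZ 2025 Thm 3.2).
[cite: CoppersmithWinograd1990, §6] [cite: BurgisserClausenShokrollahi1997, §15.8 (pp. 383–384)]
[cite: AlmanDuanVassilevskaWilliamsXuXuZhou2025, Thm. 3.2] [cite: LeGall2014, Appendix A] -/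
theorem omegaRect_cwSix_le (q n₁ n₂ n₃ n₄ n₅ n₆ x : ℕ) (hq : 2 ≤ q)
    (hN : 1 ≤ n₁ + n₂ + n₃ + n₄ + n₅ + n₆)
    (hX : (q + 2) ^ (n₁ + n₂ + n₃ + n₄ + n₅ + n₆) *
        ((n₂ + n₅ + n₆) ^ (n₂ + n₅ + n₆) * (n₁ + n₃) ^ (n₁ + n₃) * n₄ ^ n₄) ≤
      (n₁ + n₂ + n₃ + n₄ + n₅ + n₆) ^ (n₁ + n₂ + n₃ + n₄ + n₅ + n₆) * q ^ x)
    (hY : (q + 2) ^ (n₁ + n₂ + n₃ + n₄ + n₅ + n₆) *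
        ((n₃ + n₄ + n₆) ^ (n₃ + n₄ + n₆) * (n₁ + n₂) ^ (n₁ + n₂) * n₅ ^ n₅) ≤
      (n₁ + n₂ + n₃ + n₄ + n₅ + n₆) ^ (n₁ + n₂ + n₃ + n₄ + n₅ + n₆) * q ^ x)
    (hZ : (q + 2) ^ (n₁ + n₂ + n₃ + n₄ + n₅ + n₆) *
        ((n₁ + n₄ + n₅) ^ (n₁ + n₄ + n₅) * (n₂ + n₃) ^ (n₂ + n₃) * n₆ ^ n₆) ≤
      (n₁ + n₂ + n₃ + n₄ + n₅ + n₆) ^ (n₁ + n₂ + n₃ + n₄ + n₅ + n₆) * q ^ x) :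
    omegaRect ℂ n₁ n₂ n₃ ≤ x := by
  set N₀ : ℕ := n₁ + n₂ + n₃ + n₄ + n₅ + n₆ with hN₀
  refine le_of_forall_pos_lt_add fun δ hδ => ?_
  obtain ⟨m, hm, hT⟩ := sixThreshold q N₀ hq hN (x : ℝ) (δ / 2) (half_pos hδ)
  -- the law and the free diagonal
  set P : Fin 3 × Fin 3 × Fin 3 → ℝ := fun s =>
    ((if s = (1, 1, 0) then (q + 2) * m * n₁ else if s = (0, 1, 1) then (q + 2) * m * n₂
        else if s = (1, 0, 1) then (q + 2) * m * n₃ else if s = (2, 0, 0) then (q + 2) * m * n₄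
        else if s = (0, 2, 0) then (q + 2) * m * n₅ else if s = (0, 0, 2) then (q + 2) * m * n₆
        else 0 : ℕ) : ℝ) / ((((q + 2) * N₀ * m : ℕ)) : ℝ) with hP
  have hPs : ∀ s, P s = ((if s = (1, 1, 0) then (q + 2) * m * n₁ else if s = (0, 1, 1) then (q + 2) * m * n₂
      else if s = (1, 0, 1) then (q + 2) * m * n₃ else if s = (2, 0, 0) then (q + 2) * m * n₄
      else if s = (0, 2, 0) then (q + 2) * m * n₅ else if s = (0, 0, 2) then (q + 2) * m * n₆
      else 0 : ℕ) : ℝ) / ((((q + 2) * N₀ * m : ℕ)) : ℝ) := fun s => rfl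
  obtain ⟨Δ, hS, hcnt, hfree, hsize⟩ := sixDiagonalRaw q n₁ n₂ n₃ n₄ n₅ n₆ m hN hm P hPs
  have hent' := sixEntropy q n₁ n₂ n₃ n₄ n₅ n₆ x m hq hN hm hX hY hZ P hPs
  -- `exp(N · rate) ≤ |Δ| · loss`
  have hsize' : Real.exp (((((q + 2) * N₀ * m : ℕ)) : ℝ) *
      (Real.log ((q : ℝ) + 2) - (x : ℝ) * Real.log (q : ℝ) / N₀)) ≤
      (Δ.card : ℝ) * ((((((q + 2) * N₀ * m : ℕ)) : ℝ)) + 1) ^ 63 * 192 *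
        Real.exp (4 * Real.sqrt (Real.log 6 + ((((q + 2) * N₀ * m : ℕ)) : ℝ) * Real.log 27)) := by
    refine le_trans ?_ hsize
    set X : ℝ := min (shannonEntropy (marginalDist₁ P))
        (min (shannonEntropy (marginalDist₂ P)) (shannonEntropy (marginalDist₃ P))) -
        maxEntropyPenalty cwSupport₃ P with hXdef
    have hNr0 : (0 : ℝ) ≤ ((((q + 2) * N₀ * m : ℕ)) : ℝ) := Nat.cast_nonneg _
    rw [Real.rpow_def_of_pos two_pos, Real.exp_le_exp]
    calc ((((q + 2) * N₀ * m : ℕ)) : ℝ) * (Real.log ((q : ℝ) + 2) - (x : ℝ) * Real.log (q : ℝ) / N₀)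
        ≤ ((((q + 2) * N₀ * m : ℕ)) : ℝ) * (Real.log 2 * X) := mul_le_mul_of_nonneg_left hent' hNr0
      _ = Real.log 2 * (((((q + 2) * N₀ * m : ℕ)) : ℝ) * X) := by ring
  have hV : 1 ≤ Δ.card := by
    by_contra h0
    have h0' : Δ.card = 0 := by omega
    rw [h0', Nat.cast_zero, zero_mul, zero_mul, zero_mul] at hsize'
    exact absurd hsize' (not_le.2 (Real.exp_pos _))
  have hnum := hT Δ.card hsize'
  -- restriction and Schönhage at base `q^M`, `M = (q+2) m`
  have hres := stub_cwRectRestriction q ((q + 2) * m * n₁) ((q + 2) * m * n₂) ((q + 2) * m * n₃)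
    ((q + 2) * N₀ * m) Δ hS hcnt hfree
  have hM0 : (q + 2) * m ≠ 0 := Nat.mul_ne_zero (by omega) (by omega)
  have hqle : q ≤ q ^ ((q + 2) * m) := Nat.le_self_pow hM0 q
  have hq2 : 2 ≤ q ^ ((q + 2) * m) := hq.trans hqle
  have hasi := advxxz2025_thm32 ℂ hq2 n₁ n₂ n₃ hV
  rw [asymptoticRank_multiple_matMulTensor_congr (pow_mul q ((q + 2) * m) n₁).symm
    (pow_mul q ((q + 2) * m) n₂).symm (pow_mul q ((q + 2) * m) n₃).symm] at hasi
  push_cast at hasi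
  have h2 := asymptoticRank_le_of_polyDegeneratesTo hres.polyDegeneratesTo
  have hcw : asymptoticRank (bigCwTensor ℂ q) ≤ (q : ℝ) + 2 := by
    exact_mod_cast asymptoticRank_bigCwTensor_le ℂ q
  have hNpos : 0 < (q + 2) * N₀ * m := Nat.mul_pos (Nat.mul_pos (by omega) (by omega)) (by omega)
  have h3 : asymptoticRank (kroneckerPow (bigCwTensor ℂ q) ((q + 2) * N₀ * m)) ≤
      ((q : ℝ) + 2) ^ ((q + 2) * N₀ * m) :=
    (asymptoticRank_kroneckerPow_le (bigCwTensor ℂ q) hNpos).trans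
      (pow_le_pow_left₀ (asymptoticRank_nonneg _) hcw ((q + 2) * N₀ * m))
  have hchain : (Δ.card : ℝ) * ((q : ℝ) ^ ((q + 2) * m)) ^ omegaRect ℂ n₁ n₂ n₃ ≤
      (Δ.card : ℝ) * ((q : ℝ) ^ ((q + 2) * m)) ^ ((x : ℝ) + δ / 2) :=
    hasi.trans (h2.trans (h3.trans hnum))
  have hV0 : (0 : ℝ) < Δ.card := by exact_mod_cast hV
  have h4 : ((q : ℝ) ^ ((q + 2) * m)) ^ omegaRect ℂ n₁ n₂ n₃ ≤
      ((q : ℝ) ^ ((q + 2) * m)) ^ ((x : ℝ) + δ / 2) :=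
    le_of_mul_le_mul_left hchain hV0
  have hq1 : (1 : ℝ) < (q : ℝ) ^ ((q + 2) * m) := by
    have h : ((2 : ℕ) : ℝ) ≤ ((q ^ ((q + 2) * m) : ℕ) : ℝ) := by exact_mod_cast hq2
    push_cast at h
    linarith
  have h5 : omegaRect ℂ n₁ n₂ n₃ ≤ (x : ℝ) + δ / 2 := (Real.rpow_le_rpow_left_iff hq1).1 h4
  linarith

/-- The level-1 theorem with the information lower bound `ω(n₁,n₂,n₃) ≥ n₁ + n₃`: a certificate at
`x = n₁ + n₃` is an EXACT point. [cite: HuangPan1998, §2 eq. (2.8) (p. 262)] -/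
theorem omegaRect_cwSix_eq (q n₁ n₂ n₃ n₄ n₅ n₆ : ℕ) (hq : 2 ≤ q)
    (hN : 1 ≤ n₁ + n₂ + n₃ + n₄ + n₅ + n₆)
    (hX : (q + 2) ^ (n₁ + n₂ + n₃ + n₄ + n₅ + n₆) *
        ((n₂ + n₅ + n₆) ^ (n₂ + n₅ + n₆) * (n₁ + n₃) ^ (n₁ + n₃) * n₄ ^ n₄) ≤
      (n₁ + n₂ + n₃ + n₄ + n₅ + n₆) ^ (n₁ + n₂ + n₃ + n₄ + n₅ + n₆) * q ^ (n₁ + n₃))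
    (hY : (q + 2) ^ (n₁ + n₂ + n₃ + n₄ + n₅ + n₆) *
        ((n₃ + n₄ + n₆) ^ (n₃ + n₄ + n₆) * (n₁ + n₂) ^ (n₁ + n₂) * n₅ ^ n₅) ≤
      (n₁ + n₂ + n₃ + n₄ + n₅ + n₆) ^ (n₁ + n₂ + n₃ + n₄ + n₅ + n₆) * q ^ (n₁ + n₃))
    (hZ : (q + 2) ^ (n₁ + n₂ + n₃ + n₄ + n₅ + n₆) *
        ((n₁ + n₄ + n₅) ^ (n₁ + n₄ + n₅) * (n₂ + n₃) ^ (n₂ + n₃) * n₆ ^ n₆) ≤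
      (n₁ + n₂ + n₃ + n₄ + n₅ + n₆) ^ (n₁ + n₂ + n₃ + n₄ + n₅ + n₆) * q ^ (n₁ + n₃)) :
    omegaRect ℂ n₁ n₂ n₃ = (n₁ : ℝ) + n₃ := by
  refine le_antisymm ?_ (add_le_omegaRect₁₃ ℂ n₁ n₂ n₃)
  exact_mod_cast omegaRect_cwSix_le q n₁ n₂ n₃ n₄ n₅ n₆ (n₁ + n₃) hq hN hX hY hZ

/-- Normalisation `ω(S, Z, S) ≤ x ⇒ ω(1, Z/S, 1) ≤ x/S` (homogeneity, Lotti–Romani 1983).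
[cite: LottiRomani1983, §1 (p. 173)] -/
theorem omegaRect_one_div_one_le {S Z : ℕ} {x : ℝ} (hS : 1 ≤ S) (h : omegaRect ℂ S Z S ≤ x) :
    omegaRect ℂ 1 ((Z : ℝ) / S) 1 ≤ x / S := by
  have hS0 : (0 : ℝ) < S := by exact_mod_cast hS
  have hhom := LottiRomani1983_homogeneous ℂ hS0.le zero_le_one
    (by positivity : (0 : ℝ) ≤ (Z : ℝ) / S) zero_le_one
  have e : omegaRect ℂ S Z S = omegaRect ℂ ((S : ℝ) * 1) ((S : ℝ) * ((Z : ℝ) / S)) ((S : ℝ) * 1) := by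
    rw [mul_one, mul_div_cancel₀ _ hS0.ne']
  rw [e, hhom] at h
  rw [le_div_iff₀ hS0]
  linarith

/-! ## §6 Corollaries: `α ≥ 77/267`, and two points of the level-1 curve -/

set_option exponentiation.threshold 4096 in
set_option maxRecDepth 16384 in
/-- **`ω(87, 25, 87) = 174`** (design `q = 6`, counts `(87, 25, 87, 29, 2, 2)`, `N₀ = 232`:
`X = (29, 174, 29)` natural, `Y = Z = (118, 112, 2)`). [cite: CoppersmithWinograd1990, §6] -/
theorem omegaRect_87_25_87 : omegaRect ℂ 87 25 87 = (87 : ℕ) + (87 : ℕ) :=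
  omegaRect_cwSix_eq 6 87 25 87 29 2 2 (by norm_num) (by norm_num) (by decide) (by decide) (by decide)

set_option exponentiation.threshold 4096 in
set_option maxRecDepth 16384 in
/-- **`ω(267, 77, 267) = 534`** (design `q = 6`, counts `(267, 77, 267, 89, 6, 6)`, `N₀ = 712`:
`X = (89, 534, 89)` natural, `Y = Z = (362, 344, 6)`; `6/89` is the least corner mass ratio the
`Y/Z`-certificate allows, `0.067409…`). [cite: CoppersmithWinograd1990, §6] -/
theorem omegaRect_267_77_267 : omegaRect ℂ 267 77 267 = (267 : ℕ) + (267 : ℕ) :=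
  omegaRect_cwSix_eq 6 267 77 267 89 6 6 (by norm_num) (by norm_num) (by decide) (by decide) (by decide)

/-- `ω(1, 25/87, 1) = 2`. [cite: LottiRomani1983, §1 (p. 173)] -/
theorem omegaRect_one_25_87_one : omegaRect ℂ 1 ((25 : ℝ) / 87) 1 = 2 := by
  have h := omegaRect_87_25_87.le
  have hle := omegaRect_one_div_one_le (S := 87) (Z := 25) (x := 174) (by norm_num)
    (by push_cast at h ⊢; linarith)
  push_cast at hle
  refine le_antisymm (hle.trans (by norm_num)) ?_
  have := add_le_omegaRect₁₃ ℂ 1 ((25 : ℝ) / 87) 1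
  linarith

/-- `ω(1, 77/267, 1) = 2`. [cite: LottiRomani1983, §1 (p. 173)] -/
theorem omegaRect_one_77_267_one : omegaRect ℂ 1 ((77 : ℝ) / 267) 1 = 2 := by
  have h := omegaRect_267_77_267.le
  have hle := omegaRect_one_div_one_le (S := 267) (Z := 77) (x := 534) (by norm_num)
    (by push_cast at h ⊢; linarith)
  push_cast at hle
  refine le_antisymm (hle.trans (by norm_num)) ?_
  have := add_le_omegaRect₁₃ ℂ 1 ((77 : ℝ) / 267) 1
  linarith

/-- **`α ≥ 25/87 = 0.28735…`** [cite: CoppersmithWinograd1990, §6] [cite: LeGall2012, §1] -/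
theorem alpha_ge_25_87 : (25 : ℝ) / 87 ≤ dualExponentAlpha ℂ :=
  (omegaRect_eq_two_iff_le_dualExponentAlpha ℂ _).1 omegaRect_one_25_87_one

/-- **`α ≥ 77/267 = 0.28839…`** — the tree's proved dual exponent after gen 20 (level-1 `α`-content
`0.28839…` of `CW_6`; the four-pattern family stops at `2/7`). [cite: CoppersmithWinograd1990, §6]
[cite: LeGall2012, §1] -/
theorem alpha_ge_77_267 : (77 : ℝ) / 267 ≤ dualExponentAlpha ℂ :=
  (omegaRect_eq_two_iff_le_dualExponentAlpha ℂ _).1 omegaRect_one_77_267_one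

/-- `α > 0.28838`. [cite: LeGall2012, §1] -/
theorem dualExponentAlpha_gt_028838 : (0.28838 : ℝ) < dualExponentAlpha ℂ :=
  lt_of_lt_of_le (by norm_num) alpha_ge_77_267

/-- `ω(1, t, 1) = 2` for every `t ≤ 77/267`. [cite: LeGall2012, §1] -/
theorem omegaRect_one_mid_one_eq_two {t : ℝ} (ht : t ≤ 77 / 267) : omegaRect ℂ 1 t 1 = 2 :=
  (omegaRect_eq_two_iff_le_dualExponentAlpha ℂ t).2 (ht.trans alpha_ge_77_267)

set_option exponentiation.threshold 4096 in
set_option maxRecDepth 16384 in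
/-- **Level-1 curve at `t = 1/2`: `ω(276, 138, 276) ≤ 567`** (design `q = 6`, counts
`(276, 138, 276, 47, 4, 4)`, `N₀ = 745`, `X = (146, 552, 47)`, `Y = Z = (327, 414, 4)`; not tight).
[cite: CoppersmithWinograd1990, §6] -/
theorem omegaRect_276_138_276 : omegaRect ℂ 276 138 276 ≤ (567 : ℕ) :=
  omegaRect_cwSix_le 6 276 138 276 47 4 4 567 (by norm_num) (by norm_num) (by decide) (by decide) (by decide)

/-- **`ω(1, 1/2, 1) ≤ 189/92 = 2.05434…`** (level-1 optimum `2.05409`; print `2.04630`).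
[cite: LeGall2012, Table 1] [cite: LottiRomani1983, §1 (p. 173)] -/
theorem omegaRect_one_half_one_le : omegaRect ℂ 1 (1 / 2) 1 ≤ 189 / 92 := by
  have h := omegaRect_one_div_one_le (S := 276) (Z := 138) (x := 567) (by norm_num)
    (by exact_mod_cast omegaRect_276_138_276)
  have e : ((138 : ℕ) : ℝ) / ((276 : ℕ) : ℝ) = 1 / 2 := by norm_num
  rw [e] at h
  exact h.trans (by norm_num)

set_option exponentiation.threshold 4096 in
set_option maxRecDepth 16384 in
/-- **Level-1 curve at `t = 2`: `ω(170, 340, 170) ≤ 556`** (design `q = 7`, counts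
`(170, 340, 170, 1, 21, 21)`, `N₀ = 723`, `X = (382, 340, 1)`, `Y = Z = (192, 510, 21)`; not tight).
[cite: CoppersmithWinograd1990, §6] -/
theorem omegaRect_170_340_170 : omegaRect ℂ 170 340 170 ≤ (556 : ℕ) :=
  omegaRect_cwSix_le 7 170 340 170 1 21 21 556 (by norm_num) (by norm_num) (by decide) (by decide) (by decide)

/-- **`ω(1, 2, 1) ≤ 278/85 = 3.27058…`** (level-1 optimum `3.26979`; the conclusion of the route's
`TailDescentTwo` is `ω(1,2,1) = 3`). [cite: HuangPan1998, §8] [cite: LottiRomani1983, §1 (p. 173)] -/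
theorem omegaRect_one_two_one_le : omegaRect ℂ 1 2 1 ≤ 278 / 85 := by
  have h := omegaRect_one_div_one_le (S := 170) (Z := 340) (x := 556) (by norm_num)
    (by exact_mod_cast omegaRect_170_340_170)
  have e : ((340 : ℕ) : ℝ) / ((170 : ℕ) : ℝ) = 2 := by norm_num
  rw [e] at h
  exact h.trans (by norm_num)

end Summit.MatrixMultiplication.MatrixMultiplication.Theorems.SaturationLadderLevelOne

end
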